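import Summits.QuantumFields.BalabanUV.Beta.CovariantKato

/-!
# `Summit.QuantumFields.BalabanUV.Beta.CovariantLaplacianGauge` — MODEL GAUGE COVARIANCE OF THE COVARIANT DERIVATIVE, ITS ADJOINT AND
# THE LAPLACIAN `D_R*D_R` UNDER SITEWISE ORTHOGONAL ROTATIONS OF THE FIBRES (generic bond structure; module 2 of road P3's reduction
# «rough-`Rm` gradient member ⇐ flat interior estimate (FG) + sup member + ONE (3.35)-shaped binder (SF)», claim «COVARIANT-FLAT-SPLIT»)

HONEST FRAMING (page 1 of everything in this cell).  Discharging `FlowStep.BetaPertH` would make Bałaban's ultraviolet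
stability UNCONDITIONAL — a constructive-QFT result; it is NOT the continuum limit and NOT the Clay problem.  This module
discharges nothing of `BetaPertH`; it is [folklore] finite-dimensional algebra, kernel-checked, by CO-OWNER #3 of binder row D4 (unit
`b2b-balaban-beta-d4-p3`, road P3 «reduction road», gen 13).  HONEST DEPENDENCY: continuum YM on T⁴ ⇐ BetaPertH ∧ nine spine estimates
(0/9 proved); BetaPertH ⇐ (D1) ∧ (D4) ∧ CAP+tail; G-an2-4 gates asym, D1 and NE2/3/4.

THE POINT.  The (SF) binder of road P3's reduction (the MODEL shape of [B9] (3.35): «on every cube there is a GAUGE in which `U = e^{iηA}`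
with `A`, `∇A` small») is a statement about a gauge-transformed family of bond matrices; to use it on the operator one needs that the MODEL's
covariant derivative `covD`, its transpose `covDT` and hence `D_R*D_R` are COVARIANT under sitewise rotations, with fibre norms invariant.
On any bond structure `src, tgt : Bd → St`, weights `c`, bond matrices `Rm`, and a gauge `g : St → (Cp → Cp → ℝ)` column-orthonormal at
every site (`Σ_k g(x)_{ki}g(x)_{kj} = δ_{ij}`), with the transformed objects given by hypotheses (no new `def`):
`f^g(x,i) = Σ_j g(x)_{ij} f(x,j)`, `w^g(b,i) = Σ_k g(b₋)_{ik} w(b,k)` (bond fields rotate at the source), `R^g_b = g(b₋)·R_b·g(b₊)ᵀ`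
(`R^g_b(i,j) = Σ_{k,l} g(b₋)_{ik} R_b(k,l) g(b₊)_{jl}`):
* §1 `col_orth_bilinear` (`Σ_k (Ta)_k(Tb)_k = Σ_p a_p b_p`), **`gauge_col_orth`** (`R^g` is column-orthonormal when `R` is);
* §2 **`covD_gauge`** `(D_{R^g} f^g)(b,i) = Σ_k g(b₋)_{ik}(D_R f)(b,k)`; **`covDT_gauge`** `(D_{R^g}* w^g)(x,i) = Σ_l g(x)_{il}(D_R* w)(x,l)`;
  **`covLap_gauge`** `(D_{R^g}*D_{R^g} f^g)(x,i) = Σ_l g(x)_{il}(D_R*D_R f)(x,l)`;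
* §3 fibre norms: `norm_gauge_site` (`‖f^g(x)‖ = ‖f(x)‖`), **`norm_covD_gauge`** (`‖(D_{R^g}f^g)(b)‖ = ‖(D_R f)(b)‖`), **`norm_covLap_gauge`**.
So every fibre-norm statement about `(D_R f, D_R*D_R f, f)` may be proved in any gauge — in particular in the (SF) gauge of a ball, where
module 1 (`CovariantLaplacianFlatSplit`) compares `D_{R^g}*D_{R^g}` with the FLAT Laplacian.

LOCATORS (shape only, nothing printed asserted; ABSOLUTE RULE): [Balaban1985BackgroundPropagators] (3.31)–(3.34) p. 395–396 (gauge
transformation laws `G′(U^u) = R(u)G′(U)R(u^{−1})`, «All these inequalities are invariant with respect to gauge transformations of U» p. 398),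
(3.35) p. 396.  Row D4: NO class change (critical-path width 0; D4 DISCHARGE NO DATE); NOT BetaPertH, NOT continuum, NOT Clay, NOT summit
progress.
-/

open scoped BigOperators
open Finset

namespace Summit.QuantumFields.BalabanUV.Beta.CovariantLaplacianGauge

open Literature.MathematicalPhysics.QuantumFieldTheory.Balaban1983to89
open Literature.MathematicalPhysics.QuantumFieldTheory.Balaban1983to89.B9Thm37Glue (covD covDT covD_apply covDT_apply)
open Summit.QuantumFields.BalabanUV.Beta.CovariantKato (col_orth_apply row_orth_of_col_orth sqrt_sum_sq_Rm)

noncomputable section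

/-! ## §1 Orthogonality bookkeeping -/

section Orth

variable {Cp : Type} [Fintype Cp] [DecidableEq Cp]

/-- Polarised isometry: for column-orthonormal `T`, `Σ_k (Σ_p T_{kp}a_p)(Σ_q T_{kq}b_q) = Σ_p a_p b_p`. [folklore] -/
theorem col_orth_bilinear (T : Cp → Cp → ℝ) (hT : ∀ i j, ∑ k, T k i * T k j = if i = j then (1 : ℝ) else 0) (a b : Cp → ℝ) :
    ∑ k, (∑ p, T k p * a p) * (∑ q, T k q * b q) = ∑ p, a p * b p := by
  calc ∑ k, (∑ p, T k p * a p) * (∑ q, T k q * b q) = ∑ k, ∑ p, a p * (T k p * ∑ q, T k q * b q) := by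
        refine Finset.sum_congr rfl fun k _ => ?_
        rw [Finset.sum_mul]
        exact Finset.sum_congr rfl fun p _ => by ring
    _ = ∑ p, a p * ∑ k, T k p * ∑ q, T k q * b q := by
        rw [Finset.sum_comm]
        exact Finset.sum_congr rfl fun p _ => by rw [Finset.mul_sum]
    _ = ∑ p, a p * b p := Finset.sum_congr rfl fun p _ => by rw [col_orth_apply T hT b p]

variable {St Bd : Type} (src tgt : Bd → St) (Rm : Bd → Cp → Cp → ℝ) (g : St → Cp → Cp → ℝ)

/-- **`R^g = g(b₋)·R·g(b₊)ᵀ` IS COLUMN-ORTHONORMAL** when `R` and the gauge are. [folklore] -/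
theorem gauge_col_orth (hRm : ∀ b i j, ∑ k, Rm b k i * Rm b k j = if i = j then (1 : ℝ) else 0)
    (hg : ∀ x i j, ∑ k, g x k i * g x k j = if i = j then (1 : ℝ) else 0)
    (Rg : Bd → Cp → Cp → ℝ) (hRg : ∀ b i j, Rg b i j = ∑ k, g (src b) i k * ∑ l, Rm b k l * g (tgt b) j l)
    (b : Bd) (i j : Cp) : ∑ k, Rg b k i * Rg b k j = if i = j then (1 : ℝ) else 0 := by
  simp only [hRg]
  rw [col_orth_bilinear (g (src b)) (hg (src b)) (fun k => ∑ l, Rm b k l * g (tgt b) i l) (fun k => ∑ l, Rm b k l * g (tgt b) j l),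
    col_orth_bilinear (Rm b) (hRm b) (fun l => g (tgt b) i l) (fun l => g (tgt b) j l)]
  exact row_orth_of_col_orth (g (tgt b)) (hg (tgt b)) i j

end Orth

/-! ## §2 Covariance of `covD`, `covDT` and the Laplacian -/

section Cov

variable {St Bd Cp : Type} [Fintype Cp] [DecidableEq Cp] (src tgt : Bd → St) (c : Bd → ℝ) (Rm : Bd → Cp → Cp → ℝ)
  (g : St → Cp → Cp → ℝ) (hg : ∀ x i j, ∑ k, g x k i * g x k j = if i = j then (1 : ℝ) else 0)
  (Rg : Bd → Cp → Cp → ℝ) (hRg : ∀ b i j, Rg b i j = ∑ k, g (src b) i k * ∑ l, Rm b k l * g (tgt b) j l)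

include hg hRg

/-- The transformed transport applied to the transformed field: `Σ_j R^g_b(i,j) f^g(b₊,j) = Σ_k g(b₋)_{ik} Σ_l R_b(k,l) f(b₊,l)`. [folklore] -/
theorem gauge_transport_apply (f fg : St × Cp → ℝ) (hfg : ∀ x i, fg (x, i) = ∑ j, g x i j * f (x, j)) (b : Bd) (i : Cp) :
    ∑ j, Rg b i j * fg (tgt b, j) = ∑ k, g (src b) i k * ∑ l, Rm b k l * f (tgt b, l) := by
  simp only [hRg, hfg]
  calc ∑ j, (∑ k, g (src b) i k * ∑ l, Rm b k l * g (tgt b) j l) * ∑ m, g (tgt b) j m * f (tgt b, m)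
      = ∑ j, ∑ k, g (src b) i k * ((∑ l, Rm b k l * g (tgt b) j l) * ∑ m, g (tgt b) j m * f (tgt b, m)) := by
        refine Finset.sum_congr rfl fun j _ => ?_
        rw [Finset.sum_mul]
        exact Finset.sum_congr rfl fun k _ => by ring
    _ = ∑ k, g (src b) i k * ∑ j, (∑ l, Rm b k l * g (tgt b) j l) * ∑ m, g (tgt b) j m * f (tgt b, m) := by
        rw [Finset.sum_comm]
        exact Finset.sum_congr rfl fun k _ => by rw [Finset.mul_sum]
    _ = ∑ k, g (src b) i k * ∑ l, Rm b k l * f (tgt b, l) := by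
        refine Finset.sum_congr rfl fun k _ => ?_
        congr 1
        calc ∑ j, (∑ l, Rm b k l * g (tgt b) j l) * ∑ m, g (tgt b) j m * f (tgt b, m)
            = ∑ j, ∑ l, Rm b k l * (g (tgt b) j l * ∑ m, g (tgt b) j m * f (tgt b, m)) := by
              refine Finset.sum_congr rfl fun j _ => ?_
              rw [Finset.sum_mul]
              exact Finset.sum_congr rfl fun l _ => by ring
          _ = ∑ l, Rm b k l * ∑ j, g (tgt b) j l * ∑ m, g (tgt b) j m * f (tgt b, m) := by
              rw [Finset.sum_comm]
              exact Finset.sum_congr rfl fun l _ => by rw [Finset.mul_sum]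
          _ = ∑ l, Rm b k l * f (tgt b, l) :=
              Finset.sum_congr rfl fun l _ => by rw [col_orth_apply (g (tgt b)) (hg (tgt b)) (fun m => f (tgt b, m)) l]

/-- **COVARIANCE OF THE COVARIANT DERIVATIVE**: `(D_{R^g} f^g)(b,i) = Σ_k g(b₋)_{ik}·(D_R f)(b,k)`. [cite: Balaban1985BackgroundPropagators,
(3.31) p.395] [folklore] -/
theorem covD_gauge (f fg : St × Cp → ℝ) (hfg : ∀ x i, fg (x, i) = ∑ j, g x i j * f (x, j)) (b : Bd) (i : Cp) :
    covD src tgt c Rg fg (b, i) = ∑ k, g (src b) i k * covD src tgt c Rm f (b, k) := by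
  rw [covD_apply, gauge_transport_apply src tgt Rm g hg Rg hRg f fg hfg b i, hfg (src b) i]
  simp only [covD_apply]
  rw [mul_sub, Finset.mul_sum, Finset.mul_sum, ← Finset.sum_sub_distrib]
  exact Finset.sum_congr rfl fun k _ => by ring

variable [Fintype Bd] [DecidableEq St]

omit hg in
/-- **COVARIANCE OF THE ADJOINT**: for bond fields rotated at the source, `(D_{R^g}* w^g)(x,i) = Σ_l g(x)_{il}·(D_R* w)(x,l)`.
[cite: Balaban1985BackgroundPropagators, (3.31) p.395] [folklore] -/
theorem covDT_gauge (hg : ∀ x i j, ∑ k, g x k i * g x k j = if i = j then (1 : ℝ) else 0)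
    (w wg : Bd × Cp → ℝ) (hwg : ∀ b i, wg (b, i) = ∑ k, g (src b) i k * w (b, k)) (x : St) (i : Cp) :
    covDT src tgt c Rg wg (x, i) = ∑ l, g x i l * covDT src tgt c Rm w (x, l) := by
  simp only [covDT_apply]
  rw [show (∑ l, g x i l * ∑ b, ((if tgt b = x then c b else 0) * ∑ k, Rm b k l * w (b, k) - (if src b = x then c b else 0) * w (b, l)))
      = ∑ b, ∑ l, g x i l * ((if tgt b = x then c b else 0) * ∑ k, Rm b k l * w (b, k) - (if src b = x then c b else 0) * w (b, l)) by
    rw [Finset.sum_comm]; exact Finset.sum_congr rfl fun l _ => by rw [Finset.mul_sum]]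
  refine Finset.sum_congr rfl fun b _ => ?_
  -- per bond: the target part and the source part
  have hT : (if tgt b = x then c b else 0) * ∑ k, Rg b k i * wg (b, k) =
      ∑ l, g x i l * ((if tgt b = x then c b else 0) * ∑ k, Rm b k l * w (b, k)) := by
    by_cases hb : tgt b = x
    · rw [if_pos hb]
      have key : ∑ k, Rg b k i * wg (b, k) = ∑ l, g x i l * ∑ p, Rm b p l * w (b, p) := by
        simp only [hRg, hwg, hb]
        calc ∑ k, (∑ p, g (src b) k p * ∑ l, Rm b p l * g x i l) * ∑ m, g (src b) k m * w (b, m)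
            = ∑ p, (∑ l, Rm b p l * g x i l) * w (b, p) :=
              col_orth_bilinear (g (src b)) (hg (src b)) (fun p => ∑ l, Rm b p l * g x i l) (fun m => w (b, m))
          _ = ∑ p, ∑ l, g x i l * (Rm b p l * w (b, p)) := by
              refine Finset.sum_congr rfl fun p _ => ?_
              rw [Finset.sum_mul]
              exact Finset.sum_congr rfl fun l _ => by ring
          _ = ∑ l, g x i l * ∑ p, Rm b p l * w (b, p) := by
              rw [Finset.sum_comm]
              exact Finset.sum_congr rfl fun l _ => by rw [Finset.mul_sum]
      rw [key, Finset.mul_sum]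
      exact Finset.sum_congr rfl fun l _ => by ring
    · simp [hb]
  have hS : (if src b = x then c b else 0) * wg (b, i) = ∑ l, g x i l * ((if src b = x then c b else 0) * w (b, l)) := by
    by_cases hb : src b = x
    · rw [if_pos hb, hwg b i, hb, Finset.mul_sum]
      exact Finset.sum_congr rfl fun l _ => by ring
    · simp [hb]
  rw [hT, hS, ← Finset.sum_sub_distrib]
  exact Finset.sum_congr rfl fun l _ => by ring

/-- **COVARIANCE OF THE LAPLACIAN**: `(D_{R^g}*D_{R^g} f^g)(x,i) = Σ_l g(x)_{il}·(D_R*D_R f)(x,l)` — the MODEL form of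
`Δ_{U^u} = R(u)Δ_U R(u^{−1})`. [cite: Balaban1985BackgroundPropagators, (3.33)–(3.34) p.396] [folklore] -/
theorem covLap_gauge (f fg : St × Cp → ℝ) (hfg : ∀ x i, fg (x, i) = ∑ j, g x i j * f (x, j)) (x : St) (i : Cp) :
    covDT src tgt c Rg (covD src tgt c Rg fg) (x, i) = ∑ l, g x i l * covDT src tgt c Rm (covD src tgt c Rm f) (x, l) :=
  covDT_gauge src tgt c Rm g Rg hRg hg (covD src tgt c Rm f) (covD src tgt c Rg fg)
    (fun b k => covD_gauge src tgt c Rm g hg Rg hRg f fg hfg b k) x i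

/-! ## §3 Fibre norms are gauge invariant -/

omit hRg [Fintype Bd] [DecidableEq St] in
/-- `‖f^g(x)‖ = ‖f(x)‖`. [folklore] -/
theorem norm_gauge_site (f fg : St × Cp → ℝ) (hfg : ∀ x i, fg (x, i) = ∑ j, g x i j * f (x, j)) (x : St) :
    Real.sqrt (∑ i, fg (x, i) ^ 2) = Real.sqrt (∑ j, f (x, j) ^ 2) := by
  simp only [hfg]
  exact sqrt_sum_sq_Rm (g x) (hg x) (fun j => f (x, j))

omit [Fintype Bd] [DecidableEq St] in
/-- **`‖(D_{R^g} f^g)(b)‖ = ‖(D_R f)(b)‖`.** [cite: Balaban1985BackgroundPropagators, p.398 «invariant with respect to gauge transformations»]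
[folklore] -/
theorem norm_covD_gauge (f fg : St × Cp → ℝ) (hfg : ∀ x i, fg (x, i) = ∑ j, g x i j * f (x, j)) (b : Bd) :
    Real.sqrt (∑ i, covD src tgt c Rg fg (b, i) ^ 2) = Real.sqrt (∑ k, covD src tgt c Rm f (b, k) ^ 2) := by
  have h : ∀ i, covD src tgt c Rg fg (b, i) = ∑ k, g (src b) i k * covD src tgt c Rm f (b, k) :=
    fun i => covD_gauge src tgt c Rm g hg Rg hRg f fg hfg b i
  simp only [h]
  exact sqrt_sum_sq_Rm (g (src b)) (hg (src b)) (fun k => covD src tgt c Rm f (b, k))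

/-- **`‖(D_{R^g}*D_{R^g} f^g)(x)‖ = ‖(D_R*D_R f)(x)‖`.** [folklore] -/
theorem norm_covLap_gauge (f fg : St × Cp → ℝ) (hfg : ∀ x i, fg (x, i) = ∑ j, g x i j * f (x, j)) (x : St) :
    Real.sqrt (∑ i, covDT src tgt c Rg (covD src tgt c Rg fg) (x, i) ^ 2) =
      Real.sqrt (∑ l, covDT src tgt c Rm (covD src tgt c Rm f) (x, l) ^ 2) := by
  have h : ∀ i, covDT src tgt c Rg (covD src tgt c Rg fg) (x, i) = ∑ l, g x i l * covDT src tgt c Rm (covD src tgt c Rm f) (x, l) :=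
    fun i => covLap_gauge src tgt c Rm g hg Rg hRg f fg hfg x i
  simp only [h]
  exact sqrt_sum_sq_Rm (g x) (hg x) (fun l => covDT src tgt c Rm (covD src tgt c Rm f) (x, l))

/-- **Any source equation transforms covariantly**: if `D_R*D_R f = u` componentwise at `x` then `D_{R^g}*D_{R^g} f^g = u^g` at `x`. [folklore] -/
theorem covLap_gauge_eq (f fg u ug : St × Cp → ℝ) (hfg : ∀ x i, fg (x, i) = ∑ j, g x i j * f (x, j))
    (hug : ∀ x i, ug (x, i) = ∑ j, g x i j * u (x, j)) (x : St) (hu : ∀ l, covDT src tgt c Rm (covD src tgt c Rm f) (x, l) = u (x, l))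
    (i : Cp) : covDT src tgt c Rg (covD src tgt c Rg fg) (x, i) = ug (x, i) := by
  rw [covLap_gauge src tgt c Rm g hg Rg hRg f fg hfg x i, hug]
  exact Finset.sum_congr rfl fun l _ => by rw [hu l]

end Cov

end

end Summit.QuantumFields.BalabanUV.Beta.CovariantLaplacianGauge
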